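/-
Copyright (c) 2026 the pub-hodgecm-mathlib formalisation cell (harness21).  Prover seat hodgecm-mathlib-K2E1-p14 (g3), Track B ∕ K2-LIT, h413 = `stmt-HodgeConjecture-24833`,
R90-TF section S8 «ContSpec-n½», socket #2 ∕ (E) road at N = 3 (S8 dealer R90-CS-plan (g2) S8-R125): the MODEL-SIDE letters of ★ p863067 `R90S8ResGAtomsLeLinesSupMidBlocksU3` —
the split `At = Top ⊔ Mid` of the ★ G-DEFS atoms, the slots spanned by their residue families, and the model letter `hatom` — PAID by linear algebra from the block-model read-backs the
U-builder has by construction (adapted residue families, injectivity on the block); (L₃-ii)∕(L₃-iii) become instances of ★ F6 ∕ ★ `mem_resGMidAtom_of_mem_gen`.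
-/
import Summits.HodgeConjecture.HodgeConjecture.Theorems.R90S8ResGAtomsLeLinesSupMidBlocksU3   -- ★ p863067 (this seat): (L₃) «of letters» `resGAtom{,K}_le_lines_sup_midBlocks_of_{mem,ae_eq,residue}`; brings ★ G-DEFS, ★ K-type defs, ★ mid-atom defs, ★ F6
import Mathlib.LinearAlgebra.Finsupp.LinearCombination                                      -- Mathlib `Finsupp.mem_span_range_iff_exists_finsupp` (coordinates in a spanning family)
import HarnessLib

/-!
# S8 #2 ∕ (E) road at N = 3 — `R90S8ResGAtomModelSplitU3`: the split `resGAtom = resGAtomTop ⊔ resGAtomMid`, the slots spanned by their residue families, and ★ p863067's model letter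
# `hatom` DISCHARGED from block-model read-backs (adapted residue families + injectivity on the block); (L₃) with `hatom` gone: `resGAtom_le_lines_sup_midBlocks_of_adapted_model`, `hL_kType_of_adapted_model`

Track B ∕ K2-LIT, crux h413 = `stmt-HodgeConjecture-24833`, route of record `HCCMUnconditional`; cell `hodgecm-mathlib`, R90-TF programme, section S8 «ContSpec-n½», socket #2's ED. 5
sub-socket (E) (S8-R68), deal S8-R125 «pay your own (L₃) letters in ONE file» (census `K2/K2E1-p14/g3/CENSUS-ModelSplit.K2E1-p14-g3.md` 3a8c5a617eceb3a8).  THEOREMS ONLY (no `def`, no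
`instance`, no `notation`, no named-fact hypothesis, no `sorry`; default heartbeats); lane `--supports stmt-HodgeConjecture-24833 --as helper` (count-neutral).  CLOSES NO SOCKET.

THE DEALER'S QUESTION, ANSWERED.  ★ G-DEFS `R90S8ResGBlockDataU3Defs` puts `resGAtom U := resGBlock ⊓ ker (snd ∘ U)`, `resGAtomTop U := resGAtom U ⊓ ker (snd ∘ fst ∘ U)`, `resGAtomMid U :=
resGAtom U ⊓ ker (fst ∘ fst ∘ U)` for a PARAMETER `U : L² →ₗ (A × M) × Λ` about which «these defs assert nothing» (its header); only `resGAtomTop ⊔ resGAtomMid ≤ resGAtom` is ★ and its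
docstring says «equality is a model letter about `U`».  Indeed `At = Top ⊔ Mid` FAILS for some `U` (`Sc = ℂ·v`, `U v = ((1, 1), 0)`: `At = Sc`, `Top = Mid = ⊥`).  So the split — and with it
★ p863067's `hatom` — is MODEL-SIDE: it follows by LINEAR ALGEBRA from data the U-builder has BY CONSTRUCTION in K2E1-p15's ★ regime `U = ι ∘ U_iso ∘ P_{Sc}` (★ `R90S8ResHBlockModelFamilyU2`
at N = 2: `hUfac`, `hUinj`) once the slots `A`, `M` are the residue coordinate spaces:
(S) TOP-SLOT SOLVABILITY `∀ v ∈ Sc, (U v).2 = 0 → ∃ v₁ ∈ Sc, U v₁ = (((U v).1.1, 0), 0)` ⟹ `At ≤ Top ⊔ Mid` (`v = v₁ + (v − v₁)`; no injectivity) ⟹ `At = Top ⊔ Mid`;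
(AD) ADAPTED RESIDUE FAMILIES `eTop k ∈ Sc ∧ U (eTop k) = ((a k, 0), 0)`, `eMid k ∈ Sc ∧ U (eMid k) = ((0, m k), 0)` with `range a` spanning `A`, `range m` spanning `M` ⟹ (S) (Finsupp
expansion), and with `hUinj : ∀ v ∈ Sc, U v = 0 → v = 0` ⟹ `Top ≤ span (range eTop)`, `Mid ≤ span (range eMid)` ⟹ `hatom : ∀ v ∈ Sc, (U v).2 = 0 → v ∈ span (range eTop) ⊔ span (range eMid)`.
Then (L₃-ii) `Top ≤ ⨆_ψ ℂ·[ψ∘det]` and (L₃-iii) `Mid ≤ ⨆_ξ resGMidBlock ξ μω` are INSTANCES of ★ F6 `mem_iSup_lineSubrep_cmDetChar_three_of_ae_eq_residue` ∕ ★ `mem_resGMidAtom_of_mem_gen` +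
★ `resGMidAtom_le_resGMidBlock`, and ★ p863067's heads lose their `hatom` binder ([MoeglinWaldspurger1995, V.3.13, VI.2]: the residual part of a cuspidal-datum block is spanned by the
residues of its Eisenstein series; [Rogawski1990, §13.9 p. 229 (i)–(ii)]: at `z = 2` the character lines, at `z = 3/2` the `πⁿ(ξ)`-blocks).
* §1 ABSTRACT (any module `H`, `U : H →ₗ (A × M) × Λ`, `Sc`): `inf_ker_snd_le_top_sup_mid_of_exists_fst` ((S) ⟹ split), `exists_mem_span_map_eq_of_adapted_top ∕ _mid` ((AD) ⟹ slot
  solvability inside `span`), `inf_ker_top_le_span_of_adapted ∕ inf_ker_mid_le_span_of_adapted`, **`atoms_mem_sup_span_of_adapted`** (= `hatom`).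
* §2 BY NAME at ★ G-DEFS: **`resGAtom_eq_resGAtomTop_sup_resGAtomMid_of_exists_fst ∕ _of_adapted`** (the SPLIT), `resGAtomTop_le_span_of_adapted`, `resGAtomMid_le_span_of_adapted`,
  **`hatom_of_adapted`** (★ p863067's `hatom` binder as conclusion).
* §3 COMPOSED: `resGAtomTop_le_lines_of_adapted_of_residue` ((L₃-ii) instance), `resGAtomMid_le_midBlocks_of_adapted_of_gen` ((L₃-iii) instance),
  **`resGAtom_le_lines_sup_midBlocks_of_adapted_model`**, **`resGAtomK_le_lines_sup_midBlocks_of_adapted_model`**, **`hL_kType_of_adapted_model`** (★ F1_qs's `hL` binder, family form,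
  `Bn := fun ξ => resGMidBlock L μ ξ μω`) — visible = the U-builder's read-backs (`hUinj`, `hTop`, `hMid`, `ha`, `hm`) + the per-class analytic letters (`heTop` in F6's currency, `heMid` generator).
HONEST LABEL: HC_CM is proved only modulo the 7 printed citations (2 remaining named inputs: hLiu418 = `stmt-HodgeConjecture-24832`, h413 = `stmt-HodgeConjecture-24833`) until
rung 0 closes; REL ≠ ★ ≠ BUILT; this file asserts no named fact and closes no socket: left to payers are the U-BUILDER's read-backs at N = 3 (the model-family brick) and the analytic
per-class letters ((L₃-i) top class `=ᵐ r·Θ` per packet via the ★ F6 chain; middle class ∈ `resGMidAtomGen`, MID road); count-neutral.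

## References
* [MoeglinWaldspurger1995] C. Mœglin, J.-L. Waldspurger, *Spectral Decomposition and Eisenstein Series* (1995), IV.1.11, V.3.13, VI.2.
* [Rogawski1990] J. D. Rogawski, *Automorphic Representations of Unitary Groups in Three Variables* (1990), §13.9 p. 229 (i)–(ii), §13.3 p. 202.
-/

set_option autoImplicit false
set_option linter.dupNamespace false  -- the mandated namespace `…HodgeConjecture.HodgeConjecture.R90.S8` (LEAD #1 L1) repeats the summit's segment

noncomputable section

open MeasureTheory Measure Set Filter Topology NumberField
open Literature.NumberTheory.Automorphic Literature.NumberTheory.Automorphic.UnitaryGroup Literature.NumberTheory.GaloisRepresentations AdelicGroupData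
open Literature.NumberTheory.Automorphic.Arthur2013.Leaves.TECR Literature.NumberTheory.Rogawski1990
open Summit.HodgeConjecture.HodgeConjecture.Cruxes.H413.K2E1ChiEisensteinTopResidueCharLineU3 (mem_iSup_lineSubrep_cmDetChar_three_of_ae_eq_residue)
open ContRepresentation
open scoped ENNReal NNReal

namespace Summit.HodgeConjecture.HodgeConjecture.R90.S8

/-! ## §1 Abstract: a three-slot block model `U : H →ₗ (A × M) × Λ` on a block `Sc` — split and spanning from model-side data -/

section Model

variable {H : Type*} [AddCommGroup H] [Module ℂ H] {A M Λ : Type*} [AddCommGroup A] [Module ℂ A] [AddCommGroup M] [Module ℂ M] [AddCommGroup Λ] [Module ℂ Λ]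

/-- **THE SPLIT `At ≤ Top ⊔ Mid` FROM TOP-SLOT SOLVABILITY** (no injectivity needed): if for every pure atom `v ∈ Sc` (`(U v).2 = 0`) some `v₁ ∈ Sc` has `U v₁ = (((U v).1.1, 0), 0)`, then
`v = v₁ + (v − v₁)` with `v₁` a top atom (middle and line coordinates `0`) and `v − v₁` a middle atom (top and line coordinates `0`). [cite: MoeglinWaldspurger1995, V.3.13, VI.2] -/
theorem inf_ker_snd_le_top_sup_mid_of_exists_fst (U : H →ₗ[ℂ] (A × M) × Λ) (Sc : Submodule ℂ H)
    (hsplit : ∀ v ∈ Sc, (U v).2 = 0 → ∃ v₁ ∈ Sc, U v₁ = (((U v).1.1, 0), 0)) :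
    Sc ⊓ LinearMap.ker ((LinearMap.snd ℂ (A × M) Λ).comp U) ≤
      (Sc ⊓ LinearMap.ker ((LinearMap.snd ℂ (A × M) Λ).comp U) ⊓ LinearMap.ker ((LinearMap.snd ℂ A M).comp ((LinearMap.fst ℂ (A × M) Λ).comp U))) ⊔
        (Sc ⊓ LinearMap.ker ((LinearMap.snd ℂ (A × M) Λ).comp U) ⊓ LinearMap.ker ((LinearMap.fst ℂ A M).comp ((LinearMap.fst ℂ (A × M) Λ).comp U))) := by
  intro v hv
  obtain ⟨hvS, hv2⟩ := Submodule.mem_inf.1 hv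
  have hv2' : (U v).2 = 0 := LinearMap.mem_ker.1 hv2
  obtain ⟨v₁, hv₁S, hUv₁⟩ := hsplit v hvS hv2'
  have hsum : v = v₁ + (v - v₁) := (add_sub_cancel v₁ v).symm
  rw [hsum]
  refine Submodule.add_mem_sup ?_ ?_
  · refine Submodule.mem_inf.2 ⟨Submodule.mem_inf.2 ⟨hv₁S, LinearMap.mem_ker.2 ?_⟩, LinearMap.mem_ker.2 ?_⟩
    · simp only [LinearMap.coe_comp, Function.comp_apply, LinearMap.snd_apply, hUv₁]
    · simp only [LinearMap.coe_comp, Function.comp_apply, LinearMap.fst_apply, LinearMap.snd_apply, hUv₁]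
  · refine Submodule.mem_inf.2 ⟨Submodule.mem_inf.2 ⟨Sc.sub_mem hvS hv₁S, LinearMap.mem_ker.2 ?_⟩, LinearMap.mem_ker.2 ?_⟩
    · simp only [LinearMap.coe_comp, Function.comp_apply, LinearMap.snd_apply, map_sub, hUv₁, hv2', sub_zero]
    · simp only [LinearMap.coe_comp, Function.comp_apply, LinearMap.fst_apply, map_sub, hUv₁, sub_self]

/-- **TOP-SLOT SOLVABILITY FROM AN ADAPTED TOP FAMILY**: if the top residue classes `eTop k ∈ Sc` have model coordinates `U (eTop k) = ((a k, 0), 0)` and `range a` spans the top slot `A`,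
then every `((x, 0), 0)` is `U v₁` for some `v₁ ∈ Sc ⊓ span (range eTop)` (Finsupp expansion of `x`). [cite: MoeglinWaldspurger1995, VI.2] -/
theorem exists_mem_span_map_eq_of_adapted_top (U : H →ₗ[ℂ] (A × M) × Λ) (Sc : Submodule ℂ H) {ιt : Type*} (eTop : ιt → H) (a : ιt → A)
    (hTop : ∀ k, eTop k ∈ Sc ∧ U (eTop k) = ((a k, 0), 0)) (ha : ∀ x : A, x ∈ Submodule.span ℂ (Set.range a)) (x : A) :
    ∃ v₁ ∈ Sc, v₁ ∈ Submodule.span ℂ (Set.range eTop) ∧ U v₁ = ((x, 0), 0) := by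
  obtain ⟨c, hc⟩ := (Finsupp.mem_span_range_iff_exists_finsupp).1 (ha x)
  refine ⟨c.sum fun i r => r • eTop i, Submodule.finsuppSum_mem ℂ Sc c _ fun i _ => Sc.smul_mem _ (hTop i).1,
    Submodule.finsuppSum_mem ℂ (Submodule.span ℂ (Set.range eTop)) c _ fun i _ => Submodule.smul_mem _ _ (Submodule.subset_span ⟨i, rfl⟩), ?_⟩
  have h1 : U (c.sum fun i r => r • eTop i) = c.sum fun i r => r • (((a i, (0 : M)), (0 : Λ)) : (A × M) × Λ) := by
    rw [map_finsuppSum]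
    exact Finsupp.sum_congr fun i _ => by rw [map_smul, (hTop i).2]
  rw [h1]
  refine Prod.ext (Prod.ext ?_ ?_) ?_
  · rw [← hc]; simp only [Finsupp.sum, Prod.fst_sum, Prod.smul_mk]
  · simp only [Finsupp.sum, Prod.fst_sum, Prod.snd_sum, Prod.smul_mk, smul_zero, Finset.sum_const_zero]
  · simp only [Finsupp.sum, Prod.snd_sum, Prod.smul_mk, smul_zero, Finset.sum_const_zero]

/-- **MIDDLE-SLOT SOLVABILITY FROM AN ADAPTED MIDDLE FAMILY** (twin of the top case): `U (eMid k) = ((0, m k), 0)`, `range m` spans `M`. [cite: MoeglinWaldspurger1995, VI.2] -/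
theorem exists_mem_span_map_eq_of_adapted_mid (U : H →ₗ[ℂ] (A × M) × Λ) (Sc : Submodule ℂ H) {ιm : Type*} (eMid : ιm → H) (m : ιm → M)
    (hMid : ∀ k, eMid k ∈ Sc ∧ U (eMid k) = ((0, m k), 0)) (hm : ∀ y : M, y ∈ Submodule.span ℂ (Set.range m)) (y : M) :
    ∃ v₂ ∈ Sc, v₂ ∈ Submodule.span ℂ (Set.range eMid) ∧ U v₂ = ((0, y), 0) := by
  obtain ⟨c, hc⟩ := (Finsupp.mem_span_range_iff_exists_finsupp).1 (hm y)
  refine ⟨c.sum fun i r => r • eMid i, Submodule.finsuppSum_mem ℂ Sc c _ fun i _ => Sc.smul_mem _ (hMid i).1,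
    Submodule.finsuppSum_mem ℂ (Submodule.span ℂ (Set.range eMid)) c _ fun i _ => Submodule.smul_mem _ _ (Submodule.subset_span ⟨i, rfl⟩), ?_⟩
  have h1 : U (c.sum fun i r => r • eMid i) = c.sum fun i r => r • ((((0 : A), m i), (0 : Λ)) : (A × M) × Λ) := by
    rw [map_finsuppSum]
    exact Finsupp.sum_congr fun i _ => by rw [map_smul, (hMid i).2]
  rw [h1]
  refine Prod.ext (Prod.ext ?_ ?_) ?_
  · simp only [Finsupp.sum, Prod.fst_sum, Prod.smul_mk, smul_zero, Finset.sum_const_zero]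
  · rw [← hc]; simp only [Finsupp.sum, Prod.fst_sum, Prod.snd_sum, Prod.smul_mk]
  · simp only [Finsupp.sum, Prod.snd_sum, Prod.smul_mk, smul_zero, Finset.sum_const_zero]

/-- **THE TOP SLOT IS SPANNED BY ITS RESIDUE FAMILY**: with `U` injective on `Sc` and an adapted spanning top family, `Top = Sc ⊓ ker (snd ∘ U) ⊓ ker (snd ∘ fst ∘ U) ≤ span (range eTop)`
(`U v = (((U v).1.1, 0), 0) = U v₁`, so `v = v₁`). [cite: MoeglinWaldspurger1995, V.3.13, VI.2] -/
theorem inf_ker_top_le_span_of_adapted (U : H →ₗ[ℂ] (A × M) × Λ) (Sc : Submodule ℂ H) {ιt : Type*} (eTop : ιt → H) (a : ιt → A)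
    (hUinj : ∀ v ∈ Sc, U v = 0 → v = 0) (hTop : ∀ k, eTop k ∈ Sc ∧ U (eTop k) = ((a k, 0), 0)) (ha : ∀ x : A, x ∈ Submodule.span ℂ (Set.range a)) :
    Sc ⊓ LinearMap.ker ((LinearMap.snd ℂ (A × M) Λ).comp U) ⊓ LinearMap.ker ((LinearMap.snd ℂ A M).comp ((LinearMap.fst ℂ (A × M) Λ).comp U)) ≤
      Submodule.span ℂ (Set.range eTop) := by
  intro v hv
  obtain ⟨hv1, hvm⟩ := Submodule.mem_inf.1 hv
  obtain ⟨hvS, hv2⟩ := Submodule.mem_inf.1 hv1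
  have hv2' : (U v).2 = 0 := LinearMap.mem_ker.1 hv2
  have hvm' : (U v).1.2 = 0 := LinearMap.mem_ker.1 hvm
  obtain ⟨v₁, hv₁S, hv₁span, hUv₁⟩ := exists_mem_span_map_eq_of_adapted_top U Sc eTop a hTop ha (U v).1.1
  have hUw : U v₁ = U v := by
    rw [hUv₁]
    exact Prod.ext (Prod.ext rfl hvm'.symm) hv2'.symm
  have hvw : v - v₁ = 0 := hUinj (v - v₁) (Sc.sub_mem hvS hv₁S) (by rw [map_sub, hUw, sub_self])
  rw [sub_eq_zero] at hvw
  rw [hvw]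
  exact hv₁span

/-- **THE MIDDLE SLOT IS SPANNED BY ITS RESIDUE FAMILY** (twin): `Mid = Sc ⊓ ker (snd ∘ U) ⊓ ker (fst ∘ fst ∘ U) ≤ span (range eMid)`. [cite: MoeglinWaldspurger1995, V.3.13, VI.2] -/
theorem inf_ker_mid_le_span_of_adapted (U : H →ₗ[ℂ] (A × M) × Λ) (Sc : Submodule ℂ H) {ιm : Type*} (eMid : ιm → H) (m : ιm → M)
    (hUinj : ∀ v ∈ Sc, U v = 0 → v = 0) (hMid : ∀ k, eMid k ∈ Sc ∧ U (eMid k) = ((0, m k), 0)) (hm : ∀ y : M, y ∈ Submodule.span ℂ (Set.range m)) :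
    Sc ⊓ LinearMap.ker ((LinearMap.snd ℂ (A × M) Λ).comp U) ⊓ LinearMap.ker ((LinearMap.fst ℂ A M).comp ((LinearMap.fst ℂ (A × M) Λ).comp U)) ≤
      Submodule.span ℂ (Set.range eMid) := by
  intro v hv
  obtain ⟨hv1, hvt⟩ := Submodule.mem_inf.1 hv
  obtain ⟨hvS, hv2⟩ := Submodule.mem_inf.1 hv1
  have hv2' : (U v).2 = 0 := LinearMap.mem_ker.1 hv2
  have hvt' : (U v).1.1 = 0 := LinearMap.mem_ker.1 hvt
  obtain ⟨v₂, hv₂S, hv₂span, hUv₂⟩ := exists_mem_span_map_eq_of_adapted_mid U Sc eMid m hMid hm (U v).1.2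
  have hUw : U v₂ = U v := by
    rw [hUv₂]
    exact Prod.ext (Prod.ext hvt'.symm rfl) hv2'.symm
  have hvw : v - v₂ = 0 := hUinj (v - v₂) (Sc.sub_mem hvS hv₂S) (by rw [map_sub, hUw, sub_self])
  rw [sub_eq_zero] at hvw
  rw [hvw]
  exact hv₂span

/-- **THE MODEL LETTER `hatom` OF ★ p863067 FROM AN ADAPTED INJECTIVE MODEL**: `U` injective on `Sc`, the top∕middle residue families adapted (`U (eTop k) = ((a k, 0), 0)`,
`U (eMid k) = ((0, m k), 0)`, members of `Sc`) with `range a`, `range m` spanning the slots ⟹ every pure atom of `Sc` lies in `span (range eTop) ⊔ span (range eMid)`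
(split by top-slot solvability, then each slot by its family). [cite: MoeglinWaldspurger1995, V.3.13, VI.2] -/
theorem atoms_mem_sup_span_of_adapted (U : H →ₗ[ℂ] (A × M) × Λ) (Sc : Submodule ℂ H) {ιt ιm : Type*} (eTop : ιt → H) (eMid : ιm → H) (a : ιt → A) (m : ιm → M)
    (hUinj : ∀ v ∈ Sc, U v = 0 → v = 0) (hTop : ∀ k, eTop k ∈ Sc ∧ U (eTop k) = ((a k, 0), 0)) (hMid : ∀ k, eMid k ∈ Sc ∧ U (eMid k) = ((0, m k), 0))
    (ha : ∀ x : A, x ∈ Submodule.span ℂ (Set.range a)) (hm : ∀ y : M, y ∈ Submodule.span ℂ (Set.range m)) :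
    ∀ v ∈ Sc, (U v).2 = 0 → v ∈ Submodule.span ℂ (Set.range eTop) ⊔ Submodule.span ℂ (Set.range eMid) := fun v hv hv2 =>
  (sup_le_sup (inf_ker_top_le_span_of_adapted U Sc eTop a hUinj hTop ha) (inf_ker_mid_le_span_of_adapted U Sc eMid m hUinj hMid hm))
    (inf_ker_snd_le_top_sup_mid_of_exists_fst U Sc (fun w _ _ => by
        obtain ⟨v₁, hv₁S, -, hUv₁⟩ := exists_mem_span_map_eq_of_adapted_top U Sc eTop a hTop ha (U w).1.1
        exact ⟨v₁, hv₁S, hUv₁⟩)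
      (Submodule.mem_inf.2 ⟨hv, LinearMap.mem_ker.2 hv2⟩))

end Model

/-! ## §2 BY NAME at the ★ G-DEFS slots of `U(J₃)_{L∕L⁺}`: the split `resGAtom = resGAtomTop ⊔ resGAtomMid`, the slots spanned by their residue families, and ★ p863067's `hatom` discharged -/

section CMThree

variable (L : Type) [Field L] [NumberField L] [IsCMField L]
  (μ : Measure (quasiSplit (↥(maximalRealSubfield L)) L (IsCMField.complexConj L) 3).automorphicQuotient)
  {A M Λ : Type*} [AddCommGroup A] [Module ℂ A] [AddCommGroup M] [Module ℂ M] [AddCommGroup Λ] [Module ℂ Λ]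
  (U : (quasiSplit (↥(maximalRealSubfield L)) L (IsCMField.complexConj L) 3).L2 μ →ₗ[ℂ] (A × M) × Λ)
  (K' : Subgroup (quasiSplit (↥(maximalRealSubfield L)) L (IsCMField.complexConj L) 3).Adelic) (ω : ↥K' →* ℂ) (χ₁ : HeckeCharacter L) (χ₂ : ↥(TorusDict.torus (IsCMField.complexConj L)) →ₜ* ℂˣ)

/-- **THE SPLIT, «≤» HALF, FROM TOP-SLOT SOLVABILITY**: `resGAtom L μ U K' ω χ₁ χ₂ ≤ resGAtomTop … ⊔ resGAtomMid …` (★ G-DEFS `resGAtomTop := resGAtom ⊓ ker (snd ∘ fst ∘ U)`,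
`resGAtomMid := resGAtom ⊓ ker (fst ∘ fst ∘ U)`, unfolded by `rfl`). [cite: MoeglinWaldspurger1995, V.3.13, VI.2] [cite: Rogawski1990, §13.9 p. 229] -/
theorem resGAtom_le_resGAtomTop_sup_resGAtomMid_of_exists_fst
    (hsplit : ∀ v ∈ resGBlock L μ K' ω χ₁ χ₂, (U v).2 = 0 → ∃ v₁ ∈ resGBlock L μ K' ω χ₁ χ₂, U v₁ = (((U v).1.1, 0), 0)) :
    resGAtom L μ U K' ω χ₁ χ₂ ≤ resGAtomTop L μ U K' ω χ₁ χ₂ ⊔ resGAtomMid L μ U K' ω χ₁ χ₂ :=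
  inf_ker_snd_le_top_sup_mid_of_exists_fst U (resGBlock L μ K' ω χ₁ χ₂) hsplit

/-- **THE SPLIT `resGAtom = resGAtomTop ⊔ resGAtomMid`** from top-slot solvability (with ★ `resGAtomTop_sup_resGAtomMid_le_resGAtom` for «≥») — the model-side letter ★ G-DEFS :197 names
(«equality is a model letter about `U`»). [cite: MoeglinWaldspurger1995, V.3.13, VI.2] [cite: Rogawski1990, §13.9 p. 229] -/
theorem resGAtom_eq_resGAtomTop_sup_resGAtomMid_of_exists_fst
    (hsplit : ∀ v ∈ resGBlock L μ K' ω χ₁ χ₂, (U v).2 = 0 → ∃ v₁ ∈ resGBlock L μ K' ω χ₁ χ₂, U v₁ = (((U v).1.1, 0), 0)) :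
    resGAtom L μ U K' ω χ₁ χ₂ = resGAtomTop L μ U K' ω χ₁ χ₂ ⊔ resGAtomMid L μ U K' ω χ₁ χ₂ :=
  le_antisymm (resGAtom_le_resGAtomTop_sup_resGAtomMid_of_exists_fst L μ U K' ω χ₁ χ₂ hsplit) (resGAtomTop_sup_resGAtomMid_le_resGAtom L μ U K' ω χ₁ χ₂)

/-- **THE SPLIT FROM AN ADAPTED TOP FAMILY**: if the top residue classes `eTop k ∈ Sc` have `U (eTop k) = ((a k, 0), 0)` with `range a` spanning `A` (the U-builder's read-backs), then
`resGAtom = resGAtomTop ⊔ resGAtomMid`. [cite: MoeglinWaldspurger1995, V.3.13, VI.2] [cite: Rogawski1990, §13.9 p. 229] -/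
theorem resGAtom_eq_resGAtomTop_sup_resGAtomMid_of_adapted {ιt : Type*} (eTop : ιt → (quasiSplit (↥(maximalRealSubfield L)) L (IsCMField.complexConj L) 3).L2 μ) (a : ιt → A)
    (hTop : ∀ k, eTop k ∈ resGBlock L μ K' ω χ₁ χ₂ ∧ U (eTop k) = ((a k, 0), 0)) (ha : ∀ x : A, x ∈ Submodule.span ℂ (Set.range a)) :
    resGAtom L μ U K' ω χ₁ χ₂ = resGAtomTop L μ U K' ω χ₁ χ₂ ⊔ resGAtomMid L μ U K' ω χ₁ χ₂ :=
  resGAtom_eq_resGAtomTop_sup_resGAtomMid_of_exists_fst L μ U K' ω χ₁ χ₂ fun v _ _ => by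
    obtain ⟨v₁, hv₁S, -, hUv₁⟩ := exists_mem_span_map_eq_of_adapted_top U (resGBlock L μ K' ω χ₁ χ₂) eTop a hTop ha (U v).1.1
    exact ⟨v₁, hv₁S, hUv₁⟩

/-- **THE TOP SLOT IS SPANNED BY THE TOP RESIDUE CLASSES**: `resGAtomTop L μ U K' ω χ₁ χ₂ ≤ span (range eTop)` for `U` injective on the block and an adapted spanning top family.
[cite: MoeglinWaldspurger1995, V.3.13, VI.2] [cite: Rogawski1990, §13.9 p. 229 (i)] -/
theorem resGAtomTop_le_span_of_adapted {ιt : Type*} (eTop : ιt → (quasiSplit (↥(maximalRealSubfield L)) L (IsCMField.complexConj L) 3).L2 μ) (a : ιt → A)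
    (hUinj : ∀ v ∈ resGBlock L μ K' ω χ₁ χ₂, U v = 0 → v = 0) (hTop : ∀ k, eTop k ∈ resGBlock L μ K' ω χ₁ χ₂ ∧ U (eTop k) = ((a k, 0), 0))
    (ha : ∀ x : A, x ∈ Submodule.span ℂ (Set.range a)) :
    resGAtomTop L μ U K' ω χ₁ χ₂ ≤ Submodule.span ℂ (Set.range eTop) :=
  inf_ker_top_le_span_of_adapted U (resGBlock L μ K' ω χ₁ χ₂) eTop a hUinj hTop ha

/-- **THE MIDDLE SLOT IS SPANNED BY THE MIDDLE RESIDUE CLASSES**: `resGAtomMid L μ U K' ω χ₁ χ₂ ≤ span (range eMid)` for `U` injective on the block and an adapted spanning middle family.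
[cite: MoeglinWaldspurger1995, V.3.13, VI.2] [cite: Rogawski1990, §13.9 p. 229 (ii)] -/
theorem resGAtomMid_le_span_of_adapted {ιm : Type*} (eMid : ιm → (quasiSplit (↥(maximalRealSubfield L)) L (IsCMField.complexConj L) 3).L2 μ) (m : ιm → M)
    (hUinj : ∀ v ∈ resGBlock L μ K' ω χ₁ χ₂, U v = 0 → v = 0) (hMid : ∀ k, eMid k ∈ resGBlock L μ K' ω χ₁ χ₂ ∧ U (eMid k) = ((0, m k), 0))
    (hm : ∀ y : M, y ∈ Submodule.span ℂ (Set.range m)) :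
    resGAtomMid L μ U K' ω χ₁ χ₂ ≤ Submodule.span ℂ (Set.range eMid) :=
  inf_ker_mid_le_span_of_adapted U (resGBlock L μ K' ω χ₁ χ₂) eMid m hUinj hMid hm

/-- **★ p863067's MODEL LETTER `hatom` DISCHARGED FROM THE ADAPTED INJECTIVE MODEL** (conclusion = its `hatom` binder VERBATIM): `U` injective on `resGBlock L μ K' ω χ₁ χ₂`, top∕middle
residue families adapted with spanning coordinates ⟹ `∀ v ∈ resGBlock …, (U v).2 = 0 → v ∈ span (range eTop) ⊔ span (range eMid)`. [cite: MoeglinWaldspurger1995, V.3.13, VI.2] [cite: Rogawski1990, §13.9 p. 229] -/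
theorem hatom_of_adapted {ιt ιm : Type*} (eTop : ιt → (quasiSplit (↥(maximalRealSubfield L)) L (IsCMField.complexConj L) 3).L2 μ) (eMid : ιm → (quasiSplit (↥(maximalRealSubfield L)) L (IsCMField.complexConj L) 3).L2 μ) (a : ιt → A) (m : ιm → M)
    (hUinj : ∀ v ∈ resGBlock L μ K' ω χ₁ χ₂, U v = 0 → v = 0)
    (hTop : ∀ k, eTop k ∈ resGBlock L μ K' ω χ₁ χ₂ ∧ U (eTop k) = ((a k, 0), 0)) (hMid : ∀ k, eMid k ∈ resGBlock L μ K' ω χ₁ χ₂ ∧ U (eMid k) = ((0, m k), 0))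
    (ha : ∀ x : A, x ∈ Submodule.span ℂ (Set.range a)) (hm : ∀ y : M, y ∈ Submodule.span ℂ (Set.range m)) :
    ∀ v ∈ resGBlock L μ K' ω χ₁ χ₂, (U v).2 = 0 → v ∈ Submodule.span ℂ (Set.range eTop) ⊔ Submodule.span ℂ (Set.range eMid) :=
  atoms_mem_sup_span_of_adapted U (resGBlock L μ K' ω χ₁ χ₂) eTop eMid a m hUinj hTop hMid ha hm

end CMThree

/-! ## §3 Composed with ★ p863067: (L₃) with `hatom` DISCHARGED — visible = the model-side read-backs + the per-class analytic letters -/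

section Composed

variable (L : Type) [Field L] [NumberField L] [IsCMField L]
  (μ : Measure (quasiSplit (↥(maximalRealSubfield L)) L (IsCMField.complexConj L) 3).automorphicQuotient) [(quasiSplit (↥(maximalRealSubfield L)) L (IsCMField.complexConj L) 3).IsAutomorphicMeasure μ]
  {A M Λ : Type*} [AddCommGroup A] [Module ℂ A] [AddCommGroup M] [Module ℂ M] [AddCommGroup Λ] [Module ℂ Λ]

/-- **(L₃-ii) INSTANCE — THE TOP SLOT LIES IN THE CHARACTER LINES**: adapted injective model + per top class T2-FINAL's shape `∀ g, F g = r·Θ g` with `⇑(eTop k) =ᵐ x ↦ F((out x)⁻¹)`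
(★ F6 `mem_iSup_lineSubrep_cmDetChar_three_of_ae_eq_residue`) ⟹ `resGAtomTop L μ U K' ω χ₁ χ₂ ≤ ⨆_ψ ℂ·[ψ∘det]`. [cite: Rogawski1990, §13.9 p. 229 (i), §13.3 p. 202] [cite: MoeglinWaldspurger1995, IV.1.11] -/
theorem resGAtomTop_le_lines_of_adapted_of_residue (U : (quasiSplit (↥(maximalRealSubfield L)) L (IsCMField.complexConj L) 3).L2 μ →ₗ[ℂ] (A × M) × Λ)
    (K' : Subgroup (quasiSplit (↥(maximalRealSubfield L)) L (IsCMField.complexConj L) 3).Adelic) (ω : ↥K' →* ℂ) (χ₁ : HeckeCharacter L) (χ₂ : ↥(TorusDict.torus (IsCMField.complexConj L)) →ₜ* ℂˣ)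
    {ιt : Type*} (eTop : ιt → (quasiSplit (↥(maximalRealSubfield L)) L (IsCMField.complexConj L) 3).L2 μ) (a : ιt → A)
    (hUinj : ∀ v ∈ resGBlock L μ K' ω χ₁ χ₂, U v = 0 → v = 0) (hTop : ∀ k, eTop k ∈ resGBlock L μ K' ω χ₁ χ₂ ∧ U (eTop k) = ((a k, 0), 0))
    (ha : ∀ x : A, x ∈ Submodule.span ℂ (Set.range a))
    (heTop : ∀ k, ∃ (Θ : (quasiSplit (↥(maximalRealSubfield L)) L (IsCMField.complexConj L) 3).AutomorphicCharacter) (F : (quasiSplit (↥(maximalRealSubfield L)) L (IsCMField.complexConj L) 3).Adelic → ℂ) (r : ℂ), (∀ g, F g = r * ((Θ g : ℂˣ) : ℂ)) ∧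
      ((eTop k : (quasiSplit (↥(maximalRealSubfield L)) L (IsCMField.complexConj L) 3).L2 μ) : (quasiSplit (↥(maximalRealSubfield L)) L (IsCMField.complexConj L) 3).automorphicQuotient → ℂ) =ᵐ[μ]
        fun x => F (Quotient.out (x : (quasiSplit (↥(maximalRealSubfield L)) L (IsCMField.complexConj L) 3).Adelic ⧸ (quasiSplit (↥(maximalRealSubfield L)) L (IsCMField.complexConj L) 3).quotientSubgroup))⁻¹) :
    resGAtomTop L μ U K' ω χ₁ χ₂ ≤ (⨆ ψ : {ψ : ↥(TorusDict.torus (IsCMField.complexConj L)) →ₜ* ℂˣ // TorusDict.IsAutomorphic (IsCMField.complexConj L) ψ},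
        (AdelicGroupData.AutomorphicCharacter.lineSubrep (𝒢 := (quasiSplit (↥(maximalRealSubfield L)) L (IsCMField.complexConj L) 3))
          (cmDetChar L 3 ((StdForm.antidiagonal 3).over L) ψ.1 ψ.2 ((Matrix.isUnit_iff_isUnit_det _).mp (StdForm.isUnit_over (StdForm.antidiagonal 3) L)).ne_zero) μ).toSubmodule) :=
  (resGAtomTop_le_span_of_adapted L μ U K' ω χ₁ χ₂ eTop a hUinj hTop ha).trans (Submodule.span_le.2 (Set.range_subset_iff.2 fun k => by
    obtain ⟨Θ, F, r, hres, h⟩ := heTop k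
    exact mem_iSup_lineSubrep_cmDetChar_three_of_ae_eq_residue L μ Θ hres h))

/-- **(L₃-iii) INSTANCE — THE MIDDLE SLOT LIES IN THE MIDDLE BLOCKS**: adapted injective model + per middle class the generator property `eMid k ∈ resGMidAtomGen L μ ξ μω K″ ω″`
(★ `mem_resGMidAtom_of_mem_gen`, ★ `resGMidAtom_le_resGMidBlock`) ⟹ `resGAtomMid L μ U K' ω χ₁ χ₂ ≤ ⨆_ξ (resGMidBlock L μ ξ μω)`. [cite: Rogawski1990, §13.9 p. 229 (ii)] [cite: MoeglinWaldspurger1995, V.3.13] -/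
theorem resGAtomMid_le_midBlocks_of_adapted_of_gen (U : (quasiSplit (↥(maximalRealSubfield L)) L (IsCMField.complexConj L) 3).L2 μ →ₗ[ℂ] (A × M) × Λ)
    (K' : Subgroup (quasiSplit (↥(maximalRealSubfield L)) L (IsCMField.complexConj L) 3).Adelic) (ω : ↥K' →* ℂ) (χ₁ : HeckeCharacter L) (χ₂ : ↥(TorusDict.torus (IsCMField.complexConj L)) →ₜ* ℂˣ) (μω : HeckeCharacter L)
    {ιm : Type*} (eMid : ιm → (quasiSplit (↥(maximalRealSubfield L)) L (IsCMField.complexConj L) 3).L2 μ) (m : ιm → M)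
    (hUinj : ∀ v ∈ resGBlock L μ K' ω χ₁ χ₂, U v = 0 → v = 0) (hMid : ∀ k, eMid k ∈ resGBlock L μ K' ω χ₁ χ₂ ∧ U (eMid k) = ((0, m k), 0))
    (hm : ∀ y : M, y ∈ Submodule.span ℂ (Set.range m))
    (heMid : ∀ k, ∃ (ξ : OneDimAutRepH L) (K'' : Subgroup (quasiSplit (↥(maximalRealSubfield L)) L (IsCMField.complexConj L) 3).Adelic) (ω'' : ↥K'' →* ℂ), eMid k ∈ resGMidAtomGen L μ ξ μω K'' ω'') :
    resGAtomMid L μ U K' ω χ₁ χ₂ ≤ ⨆ ξ : OneDimAutRepH L, (resGMidBlock L μ ξ μω).toSubmodule :=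
  (resGAtomMid_le_span_of_adapted L μ U K' ω χ₁ χ₂ eMid m hUinj hMid hm).trans (Submodule.span_le.2 (Set.range_subset_iff.2 fun k => by
    obtain ⟨ξ, K'', ω'', hk⟩ := heMid k
    exact Submodule.mem_iSup_of_mem ξ (resGMidAtom_le_resGMidBlock L μ ξ μω K'' ω'' (mem_resGMidAtom_of_mem_gen L μ ξ μω K'' ω'' hk))))

/-- **(L₃) WITH `hatom` DISCHARGED, AT `resGAtom`**: adapted injective model (the U-builder's read-backs) + the per-class analytic letters (top: `∀ g, F g = r·Θ g` with
`⇑(eTop k) =ᵐ x ↦ F((out x)⁻¹)`; middle: generator property) ⟹ `resGAtom L μ U K' ω χ₁ χ₂ ≤ (⨆_ψ ℂ·[ψ∘det]) ⊔ ⨆_ξ (resGMidBlock L μ ξ μω)` (★ p863067 `resGAtom_le_lines_sup_midBlocks_of_residue`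
fed by `hatom_of_adapted`). [cite: Rogawski1990, §13.9 p. 229 (i)–(ii), §13.3 p. 202] [cite: MoeglinWaldspurger1995, IV.1.11, V.3.13, VI.2] -/
theorem resGAtom_le_lines_sup_midBlocks_of_adapted_model (U : (quasiSplit (↥(maximalRealSubfield L)) L (IsCMField.complexConj L) 3).L2 μ →ₗ[ℂ] (A × M) × Λ)
    (K' : Subgroup (quasiSplit (↥(maximalRealSubfield L)) L (IsCMField.complexConj L) 3).Adelic) (ω : ↥K' →* ℂ) (χ₁ : HeckeCharacter L) (χ₂ : ↥(TorusDict.torus (IsCMField.complexConj L)) →ₜ* ℂˣ) (μω : HeckeCharacter L)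
    {ιt ιm : Type*} (eTop : ιt → (quasiSplit (↥(maximalRealSubfield L)) L (IsCMField.complexConj L) 3).L2 μ) (eMid : ιm → (quasiSplit (↥(maximalRealSubfield L)) L (IsCMField.complexConj L) 3).L2 μ) (a : ιt → A) (m : ιm → M)
    (hUinj : ∀ v ∈ resGBlock L μ K' ω χ₁ χ₂, U v = 0 → v = 0)
    (hTop : ∀ k, eTop k ∈ resGBlock L μ K' ω χ₁ χ₂ ∧ U (eTop k) = ((a k, 0), 0)) (hMid : ∀ k, eMid k ∈ resGBlock L μ K' ω χ₁ χ₂ ∧ U (eMid k) = ((0, m k), 0))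
    (ha : ∀ x : A, x ∈ Submodule.span ℂ (Set.range a)) (hm : ∀ y : M, y ∈ Submodule.span ℂ (Set.range m))
    (heTop : ∀ k, ∃ (Θ : (quasiSplit (↥(maximalRealSubfield L)) L (IsCMField.complexConj L) 3).AutomorphicCharacter) (F : (quasiSplit (↥(maximalRealSubfield L)) L (IsCMField.complexConj L) 3).Adelic → ℂ) (r : ℂ), (∀ g, F g = r * ((Θ g : ℂˣ) : ℂ)) ∧
      ((eTop k : (quasiSplit (↥(maximalRealSubfield L)) L (IsCMField.complexConj L) 3).L2 μ) : (quasiSplit (↥(maximalRealSubfield L)) L (IsCMField.complexConj L) 3).automorphicQuotient → ℂ) =ᵐ[μ]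
        fun x => F (Quotient.out (x : (quasiSplit (↥(maximalRealSubfield L)) L (IsCMField.complexConj L) 3).Adelic ⧸ (quasiSplit (↥(maximalRealSubfield L)) L (IsCMField.complexConj L) 3).quotientSubgroup))⁻¹)
    (heMid : ∀ k, ∃ (ξ : OneDimAutRepH L) (K'' : Subgroup (quasiSplit (↥(maximalRealSubfield L)) L (IsCMField.complexConj L) 3).Adelic) (ω'' : ↥K'' →* ℂ), eMid k ∈ resGMidAtomGen L μ ξ μω K'' ω'') :
    resGAtom L μ U K' ω χ₁ χ₂ ≤ (⨆ ψ : {ψ : ↥(TorusDict.torus (IsCMField.complexConj L)) →ₜ* ℂˣ // TorusDict.IsAutomorphic (IsCMField.complexConj L) ψ},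
        (AdelicGroupData.AutomorphicCharacter.lineSubrep (𝒢 := (quasiSplit (↥(maximalRealSubfield L)) L (IsCMField.complexConj L) 3))
          (cmDetChar L 3 ((StdForm.antidiagonal 3).over L) ψ.1 ψ.2 ((Matrix.isUnit_iff_isUnit_det _).mp (StdForm.isUnit_over (StdForm.antidiagonal 3) L)).ne_zero) μ).toSubmodule) ⊔ ⨆ ξ : OneDimAutRepH L, (resGMidBlock L μ ξ μω).toSubmodule :=
  resGAtom_le_lines_sup_midBlocks_of_residue L μ U K' ω χ₁ χ₂ μω eTop eMid (hatom_of_adapted L μ U K' ω χ₁ χ₂ eTop eMid a m hUinj hTop hMid ha hm) heTop heMid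

/-- **(L₃) WITH `hatom` DISCHARGED, AT THE K-TYPE ATOMS OF RECORD** (`resGAtomK = resGAtom … (Kf.map ι_f) 1 … ⊓ Iso`, ★ `resGAtomK_le_resGAtom`; `Iso` idle): the model-side read-backs at the
finite level `(Kf.map ι_f, 1)` + F6's a.e. top currency `⇑(eTop k) =ᵐ x ↦ r·Θ((out x)⁻¹)` + the middle generator property. [cite: Rogawski1990, §13.9 p. 229, §13.3 p. 202] [cite: MoeglinWaldspurger1995, IV.1.11, V.3.13] -/
theorem resGAtomK_le_lines_sup_midBlocks_of_adapted_model (Iso : Submodule ℂ ((quasiSplit (↥(maximalRealSubfield L)) L (IsCMField.complexConj L) 3).L2 μ)) (U : (quasiSplit (↥(maximalRealSubfield L)) L (IsCMField.complexConj L) 3).L2 μ →ₗ[ℂ] (A × M) × Λ)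
    (Kf : Subgroup ↥(finAdelic (↥(maximalRealSubfield L)) L (IsCMField.complexConj L) 3 ((StdForm.antidiagonal 3).over L))) (χ₁ : HeckeCharacter L) (χ₂ : ↥(TorusDict.torus (IsCMField.complexConj L)) →ₜ* ℂˣ) (μω : HeckeCharacter L)
    {ιt ιm : Type*} (eTop : ιt → (quasiSplit (↥(maximalRealSubfield L)) L (IsCMField.complexConj L) 3).L2 μ) (eMid : ιm → (quasiSplit (↥(maximalRealSubfield L)) L (IsCMField.complexConj L) 3).L2 μ) (a : ιt → A) (m : ιm → M)
    (hUinj : ∀ v ∈ resGBlock L μ (Kf.map (finAdelicToAdelic (↥(maximalRealSubfield L)) L (IsCMField.complexConj L) 3 ((StdForm.antidiagonal 3).over L))) 1 χ₁ χ₂, U v = 0 → v = 0)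
    (hTop : ∀ k, eTop k ∈ resGBlock L μ (Kf.map (finAdelicToAdelic (↥(maximalRealSubfield L)) L (IsCMField.complexConj L) 3 ((StdForm.antidiagonal 3).over L))) 1 χ₁ χ₂ ∧ U (eTop k) = ((a k, 0), 0))
    (hMid : ∀ k, eMid k ∈ resGBlock L μ (Kf.map (finAdelicToAdelic (↥(maximalRealSubfield L)) L (IsCMField.complexConj L) 3 ((StdForm.antidiagonal 3).over L))) 1 χ₁ χ₂ ∧ U (eMid k) = ((0, m k), 0))
    (ha : ∀ x : A, x ∈ Submodule.span ℂ (Set.range a)) (hm : ∀ y : M, y ∈ Submodule.span ℂ (Set.range m))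
    (heTop : ∀ k, ∃ (Θ : (quasiSplit (↥(maximalRealSubfield L)) L (IsCMField.complexConj L) 3).AutomorphicCharacter) (r : ℂ), ((eTop k : (quasiSplit (↥(maximalRealSubfield L)) L (IsCMField.complexConj L) 3).L2 μ) : (quasiSplit (↥(maximalRealSubfield L)) L (IsCMField.complexConj L) 3).automorphicQuotient → ℂ) =ᵐ[μ]
        fun x => r * ((Θ (Quotient.out (x : (quasiSplit (↥(maximalRealSubfield L)) L (IsCMField.complexConj L) 3).Adelic ⧸ (quasiSplit (↥(maximalRealSubfield L)) L (IsCMField.complexConj L) 3).quotientSubgroup))⁻¹ : ℂˣ) : ℂ))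
    (heMid : ∀ k, ∃ (ξ : OneDimAutRepH L) (K'' : Subgroup (quasiSplit (↥(maximalRealSubfield L)) L (IsCMField.complexConj L) 3).Adelic) (ω'' : ↥K'' →* ℂ), eMid k ∈ resGMidAtomGen L μ ξ μω K'' ω'') :
    resGAtomK L μ Iso U Kf χ₁ χ₂ ≤ (⨆ ψ : {ψ : ↥(TorusDict.torus (IsCMField.complexConj L)) →ₜ* ℂˣ // TorusDict.IsAutomorphic (IsCMField.complexConj L) ψ},
        (AdelicGroupData.AutomorphicCharacter.lineSubrep (𝒢 := (quasiSplit (↥(maximalRealSubfield L)) L (IsCMField.complexConj L) 3))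
          (cmDetChar L 3 ((StdForm.antidiagonal 3).over L) ψ.1 ψ.2 ((Matrix.isUnit_iff_isUnit_det _).mp (StdForm.isUnit_over (StdForm.antidiagonal 3) L)).ne_zero) μ).toSubmodule) ⊔ ⨆ ξ : OneDimAutRepH L, (resGMidBlock L μ ξ μω).toSubmodule :=
  resGAtomK_le_lines_sup_midBlocks_of_ae_eq L μ Iso U Kf χ₁ χ₂ μω eTop eMid (hatom_of_adapted L μ U _ 1 χ₁ χ₂ eTop eMid a m hUinj hTop hMid ha hm) heTop heMid

/-- **★ F1_qs's `hL` BINDER AT THE K-TYPE ATOMS WITH `hatom` DISCHARGED** (family form over any index `(i, b)`; `Bn := fun ξ => resGMidBlock L μ ξ μω`): per `(i, b)` the model-side read-backs of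
the U-builder (`hUinj`, adapted families `eTop i b`, `eMid i b` with spanning coordinates `a i b`, `m i b`) and the per-class analytic letters give
`∀ i b, resGAtomK L μ (Iso i) (U i b) (Kf i) (χ₁ i b) (χ₂ i b) ≤ (⨆_ψ ℂ·[ψ∘det]) ⊔ ⨆_ξ (resGMidBlock L μ ξ μω)`. [cite: Rogawski1990, §13.9 p. 229, §13.3 p. 202] [cite: MoeglinWaldspurger1995, IV.1.11, V.3.13, VI.2] -/
theorem hL_kType_of_adapted_model {ι : Type*} {β : ι → Type*} (Iso : ι → Submodule ℂ ((quasiSplit (↥(maximalRealSubfield L)) L (IsCMField.complexConj L) 3).L2 μ)) (Kf : ι → Subgroup ↥(finAdelic (↥(maximalRealSubfield L)) L (IsCMField.complexConj L) 3 ((StdForm.antidiagonal 3).over L)))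
    {Aι Mι Λι : ∀ i, β i → Type*} [∀ i b, AddCommGroup (Aι i b)] [∀ i b, Module ℂ (Aι i b)] [∀ i b, AddCommGroup (Mι i b)] [∀ i b, Module ℂ (Mι i b)]
    [∀ i b, AddCommGroup (Λι i b)] [∀ i b, Module ℂ (Λι i b)]
    (U : ∀ (i : ι) (b : β i), (quasiSplit (↥(maximalRealSubfield L)) L (IsCMField.complexConj L) 3).L2 μ →ₗ[ℂ] (Aι i b × Mι i b) × Λι i b)
    (χ₁ : ∀ i, β i → HeckeCharacter L) (χ₂ : ∀ i, β i → (↥(TorusDict.torus (IsCMField.complexConj L)) →ₜ* ℂˣ)) (μω : HeckeCharacter L)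
    {ιt ιm : ∀ i, β i → Type*} (eTop : ∀ (i : ι) (b : β i), ιt i b → (quasiSplit (↥(maximalRealSubfield L)) L (IsCMField.complexConj L) 3).L2 μ) (eMid : ∀ (i : ι) (b : β i), ιm i b → (quasiSplit (↥(maximalRealSubfield L)) L (IsCMField.complexConj L) 3).L2 μ)
    (a : ∀ (i : ι) (b : β i), ιt i b → Aι i b) (m : ∀ (i : ι) (b : β i), ιm i b → Mι i b)
    (hUinj : ∀ (i : ι) (b : β i), ∀ v ∈ resGBlock L μ ((Kf i).map (finAdelicToAdelic (↥(maximalRealSubfield L)) L (IsCMField.complexConj L) 3 ((StdForm.antidiagonal 3).over L))) 1 (χ₁ i b) (χ₂ i b), U i b v = 0 → v = 0)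
    (hTop : ∀ (i : ι) (b : β i) (k : ιt i b), eTop i b k ∈ resGBlock L μ ((Kf i).map (finAdelicToAdelic (↥(maximalRealSubfield L)) L (IsCMField.complexConj L) 3 ((StdForm.antidiagonal 3).over L))) 1 (χ₁ i b) (χ₂ i b) ∧ U i b (eTop i b k) = ((a i b k, 0), 0))
    (hMid : ∀ (i : ι) (b : β i) (k : ιm i b), eMid i b k ∈ resGBlock L μ ((Kf i).map (finAdelicToAdelic (↥(maximalRealSubfield L)) L (IsCMField.complexConj L) 3 ((StdForm.antidiagonal 3).over L))) 1 (χ₁ i b) (χ₂ i b) ∧ U i b (eMid i b k) = ((0, m i b k), 0))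
    (ha : ∀ (i : ι) (b : β i) (x : Aι i b), x ∈ Submodule.span ℂ (Set.range (a i b))) (hm : ∀ (i : ι) (b : β i) (y : Mι i b), y ∈ Submodule.span ℂ (Set.range (m i b)))
    (heTop : ∀ (i : ι) (b : β i) (k : ιt i b), ∃ (Θ : (quasiSplit (↥(maximalRealSubfield L)) L (IsCMField.complexConj L) 3).AutomorphicCharacter) (r : ℂ), ((eTop i b k : (quasiSplit (↥(maximalRealSubfield L)) L (IsCMField.complexConj L) 3).L2 μ) : (quasiSplit (↥(maximalRealSubfield L)) L (IsCMField.complexConj L) 3).automorphicQuotient → ℂ) =ᵐ[μ]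
        fun x => r * ((Θ (Quotient.out (x : (quasiSplit (↥(maximalRealSubfield L)) L (IsCMField.complexConj L) 3).Adelic ⧸ (quasiSplit (↥(maximalRealSubfield L)) L (IsCMField.complexConj L) 3).quotientSubgroup))⁻¹ : ℂˣ) : ℂ))
    (heMid : ∀ (i : ι) (b : β i) (k : ιm i b), ∃ (ξ : OneDimAutRepH L) (K'' : Subgroup (quasiSplit (↥(maximalRealSubfield L)) L (IsCMField.complexConj L) 3).Adelic) (ω'' : ↥K'' →* ℂ), eMid i b k ∈ resGMidAtomGen L μ ξ μω K'' ω'') :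
    ∀ (i : ι) (b : β i), resGAtomK L μ (Iso i) (U i b) (Kf i) (χ₁ i b) (χ₂ i b) ≤ (⨆ ψ : {ψ : ↥(TorusDict.torus (IsCMField.complexConj L)) →ₜ* ℂˣ // TorusDict.IsAutomorphic (IsCMField.complexConj L) ψ},
        (AdelicGroupData.AutomorphicCharacter.lineSubrep (𝒢 := (quasiSplit (↥(maximalRealSubfield L)) L (IsCMField.complexConj L) 3))
          (cmDetChar L 3 ((StdForm.antidiagonal 3).over L) ψ.1 ψ.2 ((Matrix.isUnit_iff_isUnit_det _).mp (StdForm.isUnit_over (StdForm.antidiagonal 3) L)).ne_zero) μ).toSubmodule) ⊔ ⨆ ξ : OneDimAutRepH L, (resGMidBlock L μ ξ μω).toSubmodule :=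
  fun i b => resGAtomK_le_lines_sup_midBlocks_of_adapted_model L μ (Iso i) (U i b) (Kf i) (χ₁ i b) (χ₂ i b) μω (eTop i b) (eMid i b) (a i b) (m i b)
    (hUinj i b) (hTop i b) (hMid i b) (ha i b) (hm i b) (heTop i b) (heMid i b)

end Composed

end Summit.HodgeConjecture.HodgeConjecture.R90.S8

end
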